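import Summits.Ventures.LatticeQCDFlow.Scaling.SwapLadderRoundTripDEO
import Summits.Ventures.LatticeQCDFlow.Scaling.SwapLadderIndexPoisson

/-!
HONEST FRAMING: exact (Metropolis-corrected) sampling algorithms for lattice gauge theory; figures
of merit are autocorrelation/cost numbers at stated couplings and volumes; no continuum-physics
claim.

# SwapLadderIndexPoissonDEO — THE POISSON EQUATION OF THE REPLICA INDEX UNDER THE DRIVER's DETERMINISTIC EVEN–ODD
# SWAP SCHEME, SOLVED IN CLOSED FORM FOR EVERY ACCEPTANCE PROFILE: on GEN-5's lifted walk `deoWalk K a`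
# (`Fin (K+1) × Bool`) the centred index `i − K/2` has `(I − P)g = i − K/2` with `g(i,↑) = U(i) = Σ_{j<i} w_j r_j/s_j
# + i(K+1−i)/2` and `g(i,↓) = U(i) − i(K−i) − K/2` (`w_j = (j+1)(K−j)`, `s_j = a_j`, `r_j = 1 − a_j`), and
# `⟨i − K/2, g⟩_unif = (1/(K+1))·Σ_j w_j² r_j/(2s_j) + K(K+2)/24` (row 22 `su3-ptbc`, GEN-6, ours; part 1 of 2 — the
# asymptotic variance / `τ_int` and the profile-free gap to the reversible scheme are the sequel `SwapLadderIndexTauIntDEO`)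

Venture `LatticeQCDFlow` (cell pub-lqcd), topic `Scaling`; FANOUT row 22 (`su3-ptbc`).  NEW WORK of the cell over GEN-5's
`SwapLadderRoundTripDEO` (`deoWalk`, `sum_deoWalk_up/top/down/bottom`, `deoWalk_isRowStochastic` — the index process of
the deterministic even–odd scheme that `ptbc_lf.swap_step` runs), GEN-6's `SwapLadderIndexPoisson` (`unifLaw`, `levelObs`,
`passageWeight`, `sum_range_poly4`, `sum_mul_partialSum_eq`, `sum_Ico_centred_levelObs`) and the Literature vocabulary
(`PeskunOrdering`: `piInner`, `centred`, `limitMatrix`, `IsStationary`, `sum_mul_centred`; `BirthDeathChain`: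
`sum_ite_succ`, `sum_ite_pred`).  Nothing is cited as a fact; no `native_decide`.  Profile `a : ℕ → ℝ` arbitrary
(`a_j ≠ 0`, resp. `0 ≤ a ≤ 1` where stated).

## What is proved (`π = deoUnifLaw K` uniform on the lifted states)

§1 `deoUnifLaw`, `deoLevel`, **`deoPoissonUp`**, **`deoLevelPoissonRaw`** (the `↓` copy sits a PROFILE-FREE `i(K−i) + K/2`
   below the `↑` copy), `deoLevelPoisson` (centred); `sum_deoUnifLaw`, `sum_lifted`, `sum_deoUnifLaw_mul` (lifted sums as
   rung sums), mean `K/2`, `centred_deoLevel`, **`piInner_centred_deoLevel`** (`Var = K(K+2)/12`).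
§2 **`sum_deoWalk_col`** — DOUBLY STOCHASTIC for every profile; **`deoUnifLaw_isStationary`**; `sum_deoWalk_mul_const`.
§3 `deoPoissonUp_succ_sub` (`U(i+1) − U(i) = w_i r_i/s_i + (K−2i)/2`), `deoLevelPoissonRaw_up/down`,
   **`deoLevelPoissonRaw_poisson`** (four row types, every profile), **`piInner_centred_deoLevel_deoLevelPoissonRaw`** /
   `…Poisson` (summation by parts + one Faulhaber sum), `sum_deoUnifLaw_mul_deoLevelPoisson`, `deoLevelPoisson_poisson`.

NOT CLAIMED: anything about PTBC itself (ELE idealisation of CARD §1.6 / GEN-5); `τ_int` (sequel).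
-/

noncomputable section

open Finset Matrix
open Literature.Probability.MarkovChains

namespace Summit.Ventures.LatticeQCDFlow.Scaling

/-! ## §1 Objects on the lifted space `Fin (K+1) × Bool` -/

section Objects

/-- The uniform law on the `2(K+1)` lifted states (stationary: the lifted walk is doubly stochastic). [ours] -/
def deoUnifLaw (K : ℕ) : Fin (K + 1) × Bool → ℝ := fun _ => 1 / (2 * ((K : ℝ) + 1))

/-- The replica index read off a lifted state. [ours] -/
def deoLevel (K : ℕ) : Fin (K + 1) × Bool → ℝ := fun x => (x.1.val : ℝ)

/-- **The `↑`-branch of the Poisson solution** for the profile `a`: `U(i) = Σ_{j<i} w_j r_j/s_j + i(K+1−i)/2`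
(`w_j = (j+1)(K−j)`, `s_j = a_j`, `r_j = 1 − a_j`). [ours] -/
def deoPoissonUp (K : ℕ) (a : ℕ → ℝ) (i : ℕ) : ℝ :=
  ∑ j ∈ range i, passageWeight K j * (1 - a j) / a j + (i : ℝ) * ((K : ℝ) + 1 - i) / 2

/-- **The (uncentred) Poisson solution on the lifted space**: `g(i,↑) = U(i)`, `g(i,↓) = U(i) − i(K−i) − K/2` —
the `↓` copy sits a PROFILE-INDEPENDENT `i(K−i) + K/2` below the `↑` copy. [ours] -/
def deoLevelPoissonRaw (K : ℕ) (a : ℕ → ℝ) : Fin (K + 1) × Bool → ℝ := fun x =>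
  if x.2 = true then deoPoissonUp K a x.1.val
  else deoPoissonUp K a x.1.val - (x.1.val : ℝ) * ((K : ℝ) - x.1.val) - (K : ℝ) / 2

/-- The centred Poisson solution `g − π(g)`. [ours] -/
def deoLevelPoisson (K : ℕ) (a : ℕ → ℝ) : Fin (K + 1) × Bool → ℝ := fun x =>
  deoLevelPoissonRaw K a x - ∑ y, deoUnifLaw K y * deoLevelPoissonRaw K a y

variable (K : ℕ)

/-- `Σ π = 1`. [ours] -/
theorem sum_deoUnifLaw : ∑ x, deoUnifLaw K x = 1 := by
  simp only [deoUnifLaw, sum_const, card_univ, Fintype.card_prod, Fintype.card_fin, Fintype.card_bool,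
    nsmul_eq_mul]
  have : ((K : ℝ) + 1) ≠ 0 := by positivity
  push_cast
  field_simp

/-- A sum over the lifted space is the sum over rungs of the `↑` and `↓` values. [folklore] -/
theorem sum_lifted (f : Fin (K + 1) × Bool → ℝ) :
    ∑ x, f x = ∑ i : Fin (K + 1), (f (i, true) + f (i, false)) := by
  rw [Fintype.sum_prod_type]
  exact sum_congr rfl fun i _ => Fintype.sum_bool _

/-- A `π`-weighted sum over the lifted space in terms of the rung law `unifLaw K`:
`Σ_x π(x) h(x) = Σ_i unifLaw(i)·(h(i,↑) + h(i,↓))/2`. [ours] -/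
theorem sum_deoUnifLaw_mul (h : Fin (K + 1) × Bool → ℝ) :
    ∑ x, deoUnifLaw K x * h x = ∑ i : Fin (K + 1), unifLaw K i * ((h (i, true) + h (i, false)) / 2) := by
  rw [sum_lifted]
  refine sum_congr rfl fun i _ => ?_
  have : ((K : ℝ) + 1) ≠ 0 := by positivity
  simp only [deoUnifLaw, unifLaw]
  field_simp

/-- The mean index is `K/2`. [ours] -/
theorem sum_deoUnifLaw_mul_deoLevel : ∑ x, deoUnifLaw K x * deoLevel K x = (K : ℝ) / 2 := by
  rw [sum_deoUnifLaw_mul]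
  simp only [deoLevel]
  have e : ∀ i : Fin (K + 1), unifLaw K i * ((((i.val : ℝ)) + (i.val : ℝ)) / 2) = unifLaw K i * levelObs K i :=
    fun i => by simp only [levelObs]; ring
  simp_rw [e]
  exact sum_unifLaw_mul_levelObs K

/-- The centred index is `i − K/2`. [ours] -/
theorem centred_deoLevel : centred (deoUnifLaw K) (deoLevel K) = fun x => (x.1.val : ℝ) - (K : ℝ) / 2 := by
  funext x
  rw [centred, sum_deoUnifLaw_mul_deoLevel]
  rfl

/-- **`Var(index) = K(K+2)/12`** under the uniform lifted law. [ours] -/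
theorem piInner_centred_deoLevel :
    piInner (deoUnifLaw K) (centred (deoUnifLaw K) (deoLevel K)) (centred (deoUnifLaw K) (deoLevel K))
      = (K : ℝ) * (K + 2) / 12 := by
  rw [← piInner_centred_levelObs K, centred_deoLevel, centred_levelObs]
  unfold piInner
  rw [sum_deoUnifLaw_mul]
  refine sum_congr rfl fun i _ => ?_
  ring

end Objects

/-! ## §2 The lifted walk with an arbitrary profile is doubly stochastic: the uniform law is stationary -/

section Walk

variable {K : ℕ} {a : ℕ → ℝ}

/-- Column sums of the lifted walk are `1` for EVERY profile (doubly stochastic). [ours] -/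
theorem sum_deoWalk_col (a : ℕ → ℝ) (y : Fin (K + 1) × Bool) : ∑ x, deoWalk K a x y = 1 := by
  obtain ⟨j, c⟩ := y
  rw [sum_lifted]
  simp only [sum_add_distrib]
  cases c
  · -- target `(j, ↓)`: from `(j, ↑)` (rejection at bond `j`, or the top turn) and from `(j+1, ↓)` (acceptance at bond `j`)
    simp only [deoWalk_up_down, deoWalk_down_down]
    rw [Finset.sum_ite_eq univ j, if_pos (mem_univ _), sum_ite_succ j (a j.val)]
    by_cases hjK : j.val < K
    · rw [if_pos hjK, if_pos hjK]; ring
    · rw [if_neg hjK, if_neg hjK]; ring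
  · -- target `(j, ↑)`: from `(j−1, ↑)` (acceptance at bond `j−1`) and from `(j, ↓)` (rejection at bond `j−1`, or the bottom turn)
    simp only [deoWalk_up_up, deoWalk_down_up]
    have e : ∀ i : Fin (K + 1), (if j.val = i.val + 1 then a i.val else (0 : ℝ))
        = (if j.val = i.val + 1 then a (j.val - 1) else 0) := by
      intro i
      by_cases h : j.val = i.val + 1
      · rw [if_pos h, if_pos h, h, Nat.add_sub_cancel]
      · rw [if_neg h, if_neg h]
    rw [sum_congr rfl fun i _ => e i, sum_ite_pred j (a (j.val - 1)), Finset.sum_ite_eq univ j, if_pos (mem_univ _)]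
    by_cases hj0 : j.val = 0
    · rw [if_neg (by omega), if_pos hj0]; ring
    · rw [if_pos (by omega), if_neg hj0]; ring

/-- **The uniform lifted law is stationary** for every profile. [ours] -/
theorem deoUnifLaw_isStationary (a : ℕ → ℝ) : IsStationary (deoUnifLaw K) (deoWalk K a) := by
  intro y
  simp only [deoUnifLaw]
  rw [← mul_sum, sum_deoWalk_col, mul_one]

/-- Constants are harmonic for the lifted walk (`0 ≤ a ≤ 1`). [ours] -/
theorem sum_deoWalk_mul_const (ha0 : ∀ j, 0 ≤ a j) (ha1 : ∀ j, a j ≤ 1) (x : Fin (K + 1) × Bool) (c : ℝ) :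
    ∑ y, deoWalk K a x y * c = c := by
  rw [← sum_mul, (deoWalk_isRowStochastic a ha0 ha1).2 x, one_mul]

end Walk

/-! ## §3 The Poisson equation `(I − P) g = index − K/2` on the lifted space, for every profile -/

section Poisson

variable {K : ℕ} {a : ℕ → ℝ}

/-- `U` increments: `U(i+1) − U(i) = w_i r_i/s_i + (K − 2i)/2`. [ours] -/
theorem deoPoissonUp_succ_sub (K : ℕ) (a : ℕ → ℝ) (i : ℕ) :
    deoPoissonUp K a (i + 1) - deoPoissonUp K a i
      = passageWeight K i * (1 - a i) / a i + ((K : ℝ) - 2 * i) / 2 := by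
  simp only [deoPoissonUp, sum_range_succ]
  push_cast
  ring

/-- `g(i,↑)` and `g(i,↓)` unfolded. [ours] -/
theorem deoLevelPoissonRaw_up (K : ℕ) (a : ℕ → ℝ) (i : Fin (K + 1)) :
    deoLevelPoissonRaw K a (i, true) = deoPoissonUp K a i.val := by simp [deoLevelPoissonRaw]

/-- `g(i,↓) = U(i) − i(K−i) − K/2`. [ours] -/
theorem deoLevelPoissonRaw_down (K : ℕ) (a : ℕ → ℝ) (i : Fin (K + 1)) :
    deoLevelPoissonRaw K a (i, false) = deoPoissonUp K a i.val - (i.val : ℝ) * ((K : ℝ) - i.val) - (K : ℝ) / 2 := by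
  simp [deoLevelPoissonRaw]

/-- **`g = deoLevelPoissonRaw K a` solves `(I − P) g = index − K/2`** on the lifted space for EVERY profile
(`a_j ≠ 0`). [ours] -/
theorem deoLevelPoissonRaw_poisson (ha : ∀ j, a j ≠ 0) (x : Fin (K + 1) × Bool) :
    deoLevelPoissonRaw K a x - ∑ y, deoWalk K a x y * deoLevelPoissonRaw K a y = (x.1.val : ℝ) - (K : ℝ) / 2 := by
  obtain ⟨i, b⟩ := x
  have hiK : i.val ≤ K := Nat.lt_succ_iff.mp i.isLt
  cases b
  · -- down states
    by_cases hi : 0 < i.val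
    · rw [sum_deoWalk_down a _ i hi, deoLevelPoissonRaw_down, deoLevelPoissonRaw_down, deoLevelPoissonRaw_up]
      have hinc := deoPoissonUp_succ_sub K a (i.val - 1)
      rw [show i.val - 1 + 1 = i.val by omega] at hinc
      have hai : a (i.val - 1) ≠ 0 := ha _
      have hcast : (((i.val - 1 : ℕ) : ℝ)) = (i.val : ℝ) - 1 := by rw [Nat.cast_sub (by omega)]; simp
      simp only [hcast, passageWeight] at hinc
      simp only [hcast]
      set U1 := deoPoissonUp K a i.val with hU1
      set U0 := deoPoissonUp K a (i.val - 1) with hU0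
      have e : U0 = U1 - (((i.val : ℝ) - 1 + 1) * ((K : ℝ) - ((i.val : ℝ) - 1)) * (1 - a (i.val - 1)) / a (i.val - 1)
          + ((K : ℝ) - 2 * ((i.val : ℝ) - 1)) / 2) := by linarith
      rw [e]
      field_simp
      ring
    · have hi0 : i.val = 0 := by omega
      rw [sum_deoWalk_bottom a _ i hi0, deoLevelPoissonRaw_down, deoLevelPoissonRaw_up]
      simp only [hi0, Nat.cast_zero]
      ring
  · -- up states
    by_cases hi : i.val < K
    · rw [sum_deoWalk_up a _ i hi, deoLevelPoissonRaw_up, deoLevelPoissonRaw_up, deoLevelPoissonRaw_down]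
      have hinc := deoPoissonUp_succ_sub K a i.val
      have hai : a i.val ≠ 0 := ha _
      simp only [passageWeight] at hinc
      set U1 := deoPoissonUp K a (i.val + 1) with hU1
      set U0 := deoPoissonUp K a i.val with hU0
      have e : U1 = U0 + (((i.val : ℝ) + 1) * ((K : ℝ) - i.val) * (1 - a i.val) / a i.val
          + ((K : ℝ) - 2 * i.val) / 2) := by linarith
      rw [e]
      field_simp
      ring
    · have hiK' : i.val = K := by omega
      rw [sum_deoWalk_top a _ i hi, deoLevelPoissonRaw_up, deoLevelPoissonRaw_down]
      simp only [hiK', sub_self, mul_zero, sub_zero]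
      ring

/-- `⟨index − K/2, g⟩_π = (1/(K+1))·Σ_j w_j² r_j/(2s_j) + K(K+2)/24` for the uncentred solution. [ours] -/
theorem piInner_centred_deoLevel_deoLevelPoissonRaw (a : ℕ → ℝ) :
    piInner (deoUnifLaw K) (centred (deoUnifLaw K) (deoLevel K)) (deoLevelPoissonRaw K a)
      = 1 / ((K : ℝ) + 1) * ∑ j ∈ range K, passageWeight K j ^ 2 * (1 - a j) / (2 * a j) + (K : ℝ) * (K + 2) / 24 := by
  rw [centred_deoLevel]
  unfold piInner
  rw [sum_deoUnifLaw_mul]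
  simp only [deoLevelPoissonRaw_up, deoLevelPoissonRaw_down]
  -- per rung: π_i (i − K/2) (2U(i) − i(K−i) − K/2)/2 ; U(i) = S(i) + i(K+1−i)/2 with S the partial sum
  have e : ∀ i : Fin (K + 1), unifLaw K i * ((((i.val : ℝ) - (K : ℝ) / 2) * deoPoissonUp K a i.val
      + ((i.val : ℝ) - (K : ℝ) / 2) * (deoPoissonUp K a i.val - (i.val : ℝ) * ((K : ℝ) - i.val) - (K : ℝ) / 2)) / 2)
      = unifLaw K i * (((i.val : ℝ) - (K : ℝ) / 2) * ∑ j ∈ range i.val, passageWeight K j * (1 - a j) / a j)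
        + unifLaw K i * ((((i.val : ℝ) - (K : ℝ) / 2) * (i.val : ℝ) - ((i.val : ℝ) - (K : ℝ) / 2) * ((K : ℝ) / 2)) / 2) := by
    intro i; simp only [deoPoissonUp]; ring
  rw [sum_congr rfl fun i _ => e i, sum_add_distrib]
  -- first part: summation by parts, as in part 1 of the reversible file
  have h1 : ∑ i : Fin (K + 1), unifLaw K i * (((i.val : ℝ) - (K : ℝ) / 2) * ∑ j ∈ range i.val, passageWeight K j * (1 - a j) / a j)
      = 1 / ((K : ℝ) + 1) * ∑ j ∈ range K, passageWeight K j ^ 2 * (1 - a j) / (2 * a j) := by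
    simp only [unifLaw]
    rw [← mul_sum, Fin.sum_univ_eq_sum_range (fun k : ℕ => ((k : ℝ) - (K : ℝ) / 2) *
      ∑ j ∈ range k, passageWeight K j * (1 - a j) / a j) (K + 1), sum_mul_partialSum_eq]
    congr 1
    rw [sum_range_succ, Finset.Ico_self, sum_empty, mul_zero, add_zero]
    refine sum_congr rfl fun j hj => ?_
    rw [sum_Ico_centred_levelObs K (mem_range.mp hj)]
    ring
  -- second part: a polynomial sum
  have h2 : ∑ i : Fin (K + 1), unifLaw K i * ((((i.val : ℝ) - (K : ℝ) / 2) * (i.val : ℝ)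
      - ((i.val : ℝ) - (K : ℝ) / 2) * ((K : ℝ) / 2)) / 2) = (K : ℝ) * (K + 2) / 24 := by
    simp only [unifLaw]
    rw [← mul_sum, Fin.sum_univ_eq_sum_range (fun k : ℕ => ((((k : ℝ) - (K : ℝ) / 2) * (k : ℝ)
      - ((k : ℝ) - (K : ℝ) / 2) * ((K : ℝ) / 2)) / 2)) (K + 1)]
    have e2 : ∑ k ∈ range (K + 1), ((((k : ℝ) - (K : ℝ) / 2) * (k : ℝ) - ((k : ℝ) - (K : ℝ) / 2) * ((K : ℝ) / 2)) / 2)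
        = ∑ k ∈ range (K + 1), ((K : ℝ) ^ 2 / 8 + (-(K : ℝ) / 2) * (k : ℝ) + (1 / 2) * (k : ℝ) ^ 2 + 0 * (k : ℝ) ^ 3
          + 0 * (k : ℝ) ^ 4) := sum_congr rfl fun k _ => by ring
    rw [e2, sum_range_poly4]
    have : ((K : ℝ) + 1) ≠ 0 := by positivity
    push_cast
    field_simp
    ring
  rw [h1, h2]

/-- The same pairing for the centred solution. [ours] -/
theorem piInner_centred_deoLevel_deoLevelPoisson (a : ℕ → ℝ) :
    piInner (deoUnifLaw K) (centred (deoUnifLaw K) (deoLevel K)) (deoLevelPoisson K a)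
      = 1 / ((K : ℝ) + 1) * ∑ j ∈ range K, passageWeight K j ^ 2 * (1 - a j) / (2 * a j) + (K : ℝ) * (K + 2) / 24 := by
  rw [← piInner_centred_deoLevel_deoLevelPoissonRaw]
  simp only [piInner, deoLevelPoisson, mul_sub, sum_sub_distrib]
  have h0 : ∑ x, deoUnifLaw K x * (centred (deoUnifLaw K) (deoLevel K) x * ∑ y, deoUnifLaw K y * deoLevelPoissonRaw K a y)
      = 0 := by
    rw [show ∑ x, deoUnifLaw K x * (centred (deoUnifLaw K) (deoLevel K) x * ∑ y, deoUnifLaw K y * deoLevelPoissonRaw K a y)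
        = (∑ x, deoUnifLaw K x * centred (deoUnifLaw K) (deoLevel K) x) * ∑ y, deoUnifLaw K y * deoLevelPoissonRaw K a y by
          rw [sum_mul]; exact sum_congr rfl fun x _ => by ring,
      sum_mul_centred (sum_deoUnifLaw K), zero_mul]
  rw [h0, sub_zero]

/-- `deoLevelPoisson` is centred. [ours] -/
theorem sum_deoUnifLaw_mul_deoLevelPoisson (a : ℕ → ℝ) : ∑ x, deoUnifLaw K x * deoLevelPoisson K a x = 0 := by
  simp only [deoLevelPoisson, mul_sub, sum_sub_distrib]
  rw [← sum_mul, sum_deoUnifLaw, one_mul, sub_self]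

/-- The centred solution solves the Poisson equation too (`0 ≤ a ≤ 1`, `a ≠ 0`). [ours] -/
theorem deoLevelPoisson_poisson (ha0 : ∀ j, 0 < a j) (ha1 : ∀ j, a j ≤ 1) (x : Fin (K + 1) × Bool) :
    deoLevelPoisson K a x - ∑ y, deoWalk K a x y * deoLevelPoisson K a y = (x.1.val : ℝ) - (K : ℝ) / 2 := by
  rw [← deoLevelPoissonRaw_poisson (fun j => (ha0 j).ne') x]
  simp only [deoLevelPoisson, mul_sub, sum_sub_distrib]
  rw [sum_deoWalk_mul_const (fun j => (ha0 j).le) ha1]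
  ring

end Poisson

end Summit.Ventures.LatticeQCDFlow.Scaling
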